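import Summits.HubbardSuperconductivity.HubbardSuperconductivity.Theorems.AbsenceCertificateSourcedVanishingExcludesLRO
import Summits.HubbardSuperconductivity.HubbardSuperconductivity.Theorems.AbsenceCertificateSourceSlopeGlue
import Summits.HubbardSuperconductivity.HubbardSuperconductivity.Theorems.AbsenceCertificateCanonicalSupportingPotential

/-!
# Route `AbsenceCertificate`: the summit refuted MODULO the route's cruxes (record of the closed chain)

With the engine (item 9486, `sourcedOrderDominatesLRO_proof`), the schema (item 10350,
`sourcedVanishingExcludesLRO_proof`), the canonical supporting potential (item 9491,
`canonicalSupportingPotential_proof`), the glue (item 14523, `universalSourcedVanishingGlue_proof`) and the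
assembly (`closes`) all landed, every NON-crux link of route `AbsenceCertificate` is kernel-checked, and the
sub-problem statement `HubbardSuperconductivity` is refuted CONDITIONALLY on exactly one named crux:

* `not_hubbardSuperconductivity_of_universalSourcedVanishing : UniversalSourcedVanishing → ¬S` (target,
  item 9485);
* `not_hubbardSuperconductivity_of_globalSourcedVanishing : GlobalSourcedVanishing → ¬S` (crux 14356 — no
  `d_{x²-y²}` symmetry breaking under an infinitesimal pair source at any canonically supporting `μ`).

and, regionally, `not_dWaveLRO_at_stripe_point_of_stripeSourcedVanishing : StripeSourcedVanishing → ¬M(8, 1/8)`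
(crux 9488, the SSB form of the catalogued stripe no-go). All hypotheses are OPEN (the global ones expected
false at weak coupling, as the route file says); nothing here asserts them. These theorems are the honest
one-line summary of what the route now proves. No definition is introduced.
-/

set_option linter.dupNamespace false

namespace Summit.HubbardSuperconductivity.HubbardSuperconductivity.Theorems.AbsenceCertificate

open Summit.HubbardSuperconductivity.HubbardSuperconductivity.Theses.AbsenceCertificate
open Summit.HubbardSuperconductivity.HubbardSuperconductivity.Theorems

/-- **`UniversalSourcedVanishing → ¬HubbardSuperconductivity`**: the route's deciding theorem `closes` with
its schema hypothesis DISCHARGED by `sourcedVanishingExcludesLRO_proof` (Kaplan–Horsch–von der Linden /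
Koma–Tasaki: LRO forces sourced order). The remaining hypothesis is the route's target crux (item 9485).
[cite: KomaTasaki1994, Theorem 2.2] -/
theorem not_hubbardSuperconductivity_of_universalSourcedVanishing (hX : UniversalSourcedVanishing) :
    ¬ _root_.HubbardSuperconductivity :=
  closes sourcedVanishingExcludesLRO_proof hX

/-- **`GlobalSourcedVanishing → ¬HubbardSuperconductivity`**: the target is reached inside the route from
the canonical supporting potential (landed, `canonicalSupportingPotential_proof`) and the global sourced
vanishing (crux 14356) by the landed glue `universalSourcedVanishingGlue_proof`; compose with the previous
theorem. The only hypothesis left is the physical bet "no `d`-wave symmetry breaking under an infinitesimal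
pair source anywhere in the summit's box". [cite: KomaTasaki1994, §1] -/
theorem not_hubbardSuperconductivity_of_globalSourcedVanishing (hG : GlobalSourcedVanishing) :
    ¬ _root_.HubbardSuperconductivity :=
  not_hubbardSuperconductivity_of_universalSourcedVanishing
    (universalSourcedVanishingGlue_proof canonicalSupportingPotential_proof hG)

/-- **The regional no-go at the stripe point, conditional form**: if the Koma–Tasaki `d`-wave order
parameter of the pure model vanishes at `(U, δ) = (8, 1/8)` (crux `StripeSourcedVanishing`, item 9488 —
the SSB reading of QinEtAl2020), then the summit's matrix FAILS at `(8, 1/8)`: NOT every admissible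
`(N_L, S^z = 0)`-sector ground-state sequence of `hubbardTorus 2 L 1 8`, `N_L = 2⌊(7/8)L²/2⌋`, has
`d_{x²-y²}` pair-field LRO along even sides (schema `sourcedVanishingExcludesLRO_proof` at the supporting
`μ` of `canonicalSupportingPotential_proof`). [cite: KomaTasaki1994, Theorem 2.2] -/
theorem not_dWaveLRO_at_stripe_point_of_stripeSourcedVanishing (hV : StripeSourcedVanishing) :
    ¬ (∀ (N : ℕ → ℕ) (ψ : ∀ L, Literature.MathematicalPhysics.QuantumLattice.Fock
        (Literature.MathematicalPhysics.QuantumLattice.Orb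
          (Literature.MathematicalPhysics.QuantumLattice.FermionTorus 2 L))),
      (∀ L, Even L → N L = 2 * ⌊(1 - 1 / 8) * (L : ℝ) ^ 2 / 2⌋₊ ∧ star (ψ L) ⬝ᵥ ψ L = 1 ∧
        Literature.MathematicalPhysics.QuantumLattice.IsGroundStateInSector
          (Literature.MathematicalPhysics.QuantumLattice.hubbardTorus 2 L 1 8) (N L) 0 (ψ L)) →
      Literature.Probability.LatticeModels.HasLongRangeOrder
        (fun k => Literature.Probability.LatticeModels.halfOpenBox 2 (2 * k))
        (fun k => Literature.MathematicalPhysics.QuantumLattice.torusPullback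
          (Literature.MathematicalPhysics.QuantumLattice.pairFieldCorr
            Literature.MathematicalPhysics.QuantumLattice.dWaveFormFactor ψ) (2 * k))) := by
  obtain ⟨μ, hμ⟩ := canonicalSupportingPotential_proof 8 (1 / 8) ⟨by norm_num, by norm_num⟩
  exact sourcedVanishingExcludesLRO_proof 8 (by norm_num) (1 / 8) ⟨by norm_num, by norm_num⟩
    ⟨μ, hμ, hV μ hμ⟩

end Summit.HubbardSuperconductivity.HubbardSuperconductivity.Theorems.AbsenceCertificate
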